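import Literature.NumberTheory.LFunctions.Zhang2022.KnifeEdgeWallBand

/-!
# Zhang (2022), rung F-S3 (Landau–Siegel programme, family B-multi, class M2 «Λ-type coefficients»):
# registry row E-030 «E-multi-main(Lambda-type)» typed over the skeleton — the Λ-piece, the 2×2 block
# pencil `[[𝔅(u), κ_×], [κ̄_×, K_Λ]]` as a statement PARAMETRIC in `(K_Λ, κ_×)`, and its (B1) certificate proved

Y. Zhang, *Discrete mean estimates and the Landau–Siegel zero*, arXiv:2211.02515v1 [Zhang2022LandauSiegel] —
an unrefereed manuscript under adjudication. **WHAT THIS IS NOT: not a claim about Theorems 1–2 of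
arXiv:2211.02515, about Landau–Siegel zeros, or about Parity. The programme SEARCHES and TYPES; nothing here
asserts any estimate: `EMultiLambda`, `LambdaBlockCS`, `EMultiLambdaCloses`, `LambdaBlockIndefinite` are bare
`Prop`s (cell `landau-siegel`, B-multi/EDLIST.md row multi-E2a = registry E-030, child of the class parent
E-029), and every `theorem` is an implication between them, 2×2 Hermitian-form algebra, or the family positivity
endgame of `KnifeEdgeWallBand`.**

**The design class (sub-class M2 of B-multi/PLAN.md, coefficient class (O2) of the cell's OBJECTIVE.md §1.3).**
Side 1 of the manuscript's test vector carries, next to an in-class `χψ`-smooth piece `u` (one-sided kinked profile on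
`[0,1]`, main term `𝔅(u) = mainTermForm u u′ ≥ 0`), a **Λ-type piece** with coefficients
`χψ(n)·(Λ^{⋆k}(n)/log^k P)·p(log n/log P)` on `n < P^ν` (`k ≥ 1`, `0 < ν ≤ 1`; Mathlib's von Mangoldt function
`ArithmeticFunction.vonMangoldt`, `Λ^{⋆k}` = its `k`-fold Dirichlet convolution = `Λ ^ k` in the ring of arithmetic
functions) — the shape of Feng's second mollifier piece `μ⋆Λ^{⋆k}` (arXiv:1003.0059 (1.11); Kühn–Robles–Zeindler
arXiv:1605.02604 §1.2) transplanted to the (A)-world object, in which `χ` plays the role of `μ`: `LambdaPiece`,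
`lambdaWeight`, `lambdaPoly`, and the realised two-piece value table `lambdaDesign` (`H_u + c·Λ_s(D,χ)^{−1/2}·H_λ`,
BALANCED amplitude `c`, balancing scale `Λ_s` a parameter). Its diagonal main term is NOT a Gram value of `𝔅`:
ls-theory's reading (cell INBOX 2026-08-26T16:51:20Z, HEURISTIC factor counting) — the `λ×λ` diagonal is `χ`-free
(`χ² = 1` on the prime support), a genuine `|·|² ≥ 0` of the same `𝓛`-power as the dipole-suppressed smooth terms
but WITHOUT the factor `𝔞` (Q1(i)); the `u×λ` coupling keeps exactly one `L′(1,χ)`-dipole factor and is of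
geometric-mean, i.e. Cauchy–Schwarz-saturating, order (Q1(ii)); so at balanced amplitude all four entries of the block
`[[𝔅(u), κ_×(u,λ)], [κ̄_×, K_Λ(λ)]]` are of main order and its definiteness is a genuine COMPUTATION — the recipe for
the closed forms (Q1(iii): replace each dipole rule by the PNT rule in the residue-weight skeleton `(W_j, A_j, B_j)` of
formula I) is a derivation item NOT carried out here.

**The row (Part 2) = E-030 «E-multi-main(Lambda-type)»:** under (A), for every in-class piece `u`, every admissible
Λ-piece `λ` and every amplitude `c ∈ ℂ`, the discrete mean (`KnifeEdge.discMean`) of the realised design equals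
`(𝔅(u) + 2Re(κ_×(u,λ)·c) + |c|²K_Λ(λ))·𝔞𝔓 + o(𝔞𝔓)` — `EMultiLambda c' K X Λ_s`, in the
`ForAllLarge … AssumptionA → |mean − main·𝔞𝔓| ≤ ε𝔞𝔓` shape of `KnifeEdge.EStarLen` / `EMultiBand`, PARAMETRIC in
the diagonal functional `K : LambdaDiag`, the cross functional `X : LambdaCross` and the scale `Λ_s : BandScale`
(status: derivation, in-house, not started; price L; «verdict-inert unless a sourced non-model term»). The sign and
subordination CLAIMS of the derivation are the separate predicates `LambdaDiagNonneg K` (`K_Λ ≥ 0`) and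
`LambdaBlockCS K X` (`|κ_×|² ≤ 𝔅(u)·K_Λ`: the (B1) prediction — under Lemma 2.3 / `ω > 0` the true form is a sum of
`|·|²`); the EDGE REPORT shape (B-multi/PLAN.md §4 step 5: «an indefinite DERIVED block = knife edge #3») is
`LambdaBlockIndefinite K X`.

**Proved (Part 3):** the M2 certificate — `K ≥ 0` and CS-subordination give `(√𝔅(u) − |c|√K_Λ)² ≤ main ≥ 0` for
every amplitude (`lambdaBlockMainTerm_nonneg_of_cs`, via `KnifeEdge.sq_sqrt_sub_sqrt_le`), hence
`¬ EMultiLambdaCloses` (`not_eMultiLambdaCloses_of_cs`); conversely an indefinite block with `K_Λ > 0` closes at the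
amplitude `c = −conj κ_× / K_Λ` (`eMultiLambdaCloses_of_indefinite`: main `= 𝔅(u) − |κ_×|²/K_Λ < 0`), so it negates CS
(`lambdaBlockIndefinite_not_cs`); and the POS endgame as a kernel implication `EMultiLambda → EMultiLambdaCloses →
Prop22i → Lemma23 c' → Theorem1/2` (`theorem1_of_eMultiLambda`, via
`KnifeEdge.eventually_not_assumptionA_of_negative_mainTerm_family` and `Skeleton.theorem1_of_eventually_not_assumptionA`)
— which is why a derived indefinite block would first be priced as a dictionary-consistency test (ls-theory, loc. cit.).
References: Zhang, arXiv:2211.02515v1, §2 (2.15)–(2.20), Lemma 2.3, Prop. 2.2; §7 Prop 7.1, (7.2); §8 (8.3), Lemma 8.1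
[cite: Zhang2022LandauSiegel, §7 Prop 7.1 (7.2); §8 Lemma 8.1]; the transplant model S. Feng (2012) [Feng2012CriticalLine].
«The programme SEARCHES and TYPES; no claim about Landau–Siegel zeros, Theorems 1–2 of arXiv:2211.02515 or a
repaired Margin232 until a kernel theorem says so.»
-/

noncomputable section

open Complex Real Set
open _root_.MeasureTheory
open scoped ArithmeticFunction.vonMangoldt

namespace Literature.NumberTheory.LFunctions.Zhang2022

namespace KnifeEdge

open Repair Skeleton

/-! ### Part 1 — the Λ-type piece and the realised two-piece design -/

/-- **A Λ-type coefficient piece** (class (O2), Feng shape): coefficients `χψ(n)·(Λ^{⋆k}(n)/log^k P)·p(log n/log P)`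
on `n < P^{top}` — convolution order `k`, logarithmic length `top = ν`, profile `p`.
[cite: Zhang2022LandauSiegel, §7 (7.2)] [cite: Feng2012CriticalLine, (1.11)] -/
structure LambdaPiece where
  /-- convolution order `k` of `Λ^{⋆k}` (`k = 1`: primes and prime powers) -/
  k : ℕ
  /-- logarithmic length `ν` (`n < P^ν`) -/
  top : ℝ
  /-- the profile `p(z)` (a polynomial `P_k` in Feng's shape; any bounded function here) -/
  prof : ℝ → ℂ

/-- Admissibility (sub-class M2): `k ≥ 1`, `0 < ν ≤ 1` (support inside the validated range, no overhang), bounded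
profile. [cite: Zhang2022LandauSiegel, §7 (7.2)] -/
structure LambdaPiece.Admissible (L : LambdaPiece) : Prop where
  order : 1 ≤ L.k
  top_pos : 0 < L.top
  top_le : L.top ≤ 1
  bdd : ∃ B : ℝ, ∀ z, ‖L.prof z‖ ≤ B

/-- The arithmetic weight `Λ^{⋆k}(n)/L^k` (`L = log P`; `Λ ^ k` is the `k`-fold Dirichlet convolution of Mathlib's
von Mangoldt function in the ring `ArithmeticFunction ℝ`). [cite: Feng2012CriticalLine, (1.11), (1.16)] -/
def lambdaWeight (k : ℕ) (L : ℝ) (n : ℕ) : ℝ := (Λ ^ k) n / L ^ k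

/-- Unfolding lemma. [cite: Feng2012CriticalLine, (1.11)] -/
theorem lambdaWeight_def (k : ℕ) (L : ℝ) (n : ℕ) : lambdaWeight k L n = (Λ ^ k) n / L ^ k := rfl

/-- For `k = 1` the weight is `Λ(n)/L`. [cite: Feng2012CriticalLine, (1.16)] -/
theorem lambdaWeight_one (L : ℝ) (n : ℕ) : lambdaWeight 1 L n = Λ n / L := by
  simp [lambdaWeight]

/-- **The Λ-piece polynomial** `H_λ(s,ψ) = Σ_{1≤n<⌈P^ν⌉} χψ(n)·(Λ^{⋆k}(n)/log^k P)·p(log n/log P)·n^{−s}` for the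
member `x = (p, ψ)` of the family. [cite: Zhang2022LandauSiegel, §2 (2.23)–(2.25), §7 (7.2)] -/
def lambdaPoly {D : ℕ} (χ : DirichletCharacter ℂ D) (x : Chr D) (L : LambdaPiece) (s : ℂ) : ℂ :=
  ∑ n ∈ Finset.Ico 1 ⌈bigP D ^ L.top⌉₊,
    pc χ x n * ((lambdaWeight L.k (Real.log (bigP D)) n : ℝ) : ℂ) *
      L.prof (Real.log n / Real.log (bigP D)) * (n : ℂ) ^ (-s)

/-- **The realised two-piece design** `H_u + c·Λ_s^{−1/2}·H_λ` (side 1; in-class piece `u` of length `P`, Λ-piece of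
BALANCED amplitude `c` at balancing scale `Λ_s`), as a value table over the sampled pairs.
[cite: Zhang2022LandauSiegel, §2 (2.27), §7 (7.2)] -/
def lambdaDesign {D : ℕ} (χ : DirichletCharacter ℂ D) (u : ℝ → ℂ) (L : LambdaPiece) (c : ℂ) (scale : ℝ) :
    Chr D → ℂ → ℂ := fun x s =>
  profPoly χ x u ⌈bigP D⌉₊ s + c * (((Real.sqrt scale)⁻¹ : ℝ) : ℂ) * lambdaPoly χ x L s

/-- The diagonal Λ×Λ main-term functional `K_Λ(λ)` (the parameter; claimed closed form for `k = 1`: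
`∫₀^ν z·|p(z)|²dz`-type, `χ`-free, sign `+`). [cite: Zhang2022LandauSiegel, §7 Prop 7.1 (7.2)] -/
abbrev LambdaDiag : Type := LambdaPiece → ℝ

/-- The smooth × Λ cross main-term functional `κ_×(u,λ)` (the parameter; claimed of geometric-mean order, one dipole
factor). [cite: Zhang2022LandauSiegel, §7 Prop 7.1 (7.2), §8 Lemma 8.1] -/
abbrev LambdaCross : Type := (ℝ → ℂ) → (ℝ → ℂ) → LambdaPiece → ℂ

/-- **The block pencil evaluated at amplitude `c`:** `(1, c̄)·[[𝔅(u), κ_×],[κ̄_×, K_Λ]]·(1, c)ᵀ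
= 𝔅(u) + 2Re(κ_×·c) + |c|²·K_Λ` — the claimed main-order constant, in units of `𝔞𝔓`, of the discrete mean of the
realised design. [cite: Zhang2022LandauSiegel, §7 Prop 7.1 (7.2)] -/
def lambdaBlockMainTerm (K : LambdaDiag) (X : LambdaCross) (u u' : ℝ → ℂ) (L : LambdaPiece) (c : ℂ) : ℝ :=
  mainTermForm u u' + 2 * (X u u' L * c).re + ‖c‖ ^ 2 * K L

/-- Unfolding lemma. [cite: Zhang2022LandauSiegel, §7 Prop 7.1 (7.2)] -/
theorem lambdaBlockMainTerm_def (K : LambdaDiag) (X : LambdaCross) (u u' : ℝ → ℂ) (L : LambdaPiece) (c : ℂ) :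
    lambdaBlockMainTerm K X u u' L c = mainTermForm u u' + 2 * (X u u' L * c).re + ‖c‖ ^ 2 * K L := rfl

/-- At amplitude `0` the design is the in-class piece alone: main term `𝔅(u)`.
[cite: Zhang2022LandauSiegel, §7 Prop 7.1 (7.2)] -/
theorem lambdaBlockMainTerm_zero (K : LambdaDiag) (X : LambdaCross) (u u' : ℝ → ℂ) (L : LambdaPiece) :
    lambdaBlockMainTerm K X u u' L 0 = mainTermForm u u' := by
  simp [lambdaBlockMainTerm]

/-! ### Part 2 — registry row E-030 and its claims (bare `Prop`s, none asserted) -/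

/-- **E-030 «E-multi-main(Lambda-type)» — the Λ-block asymptotic, parametric in `(K_Λ, κ_×, Λ_s)`** (B-multi/EDLIST.md
multi-E2a; status: derivation, in-house, not started; price L): under (A), for every in-class kinked piece `u`
(`u(1) = 0`), every admissible Λ-piece `λ`, every amplitude `c` and every `ε > 0`, for all large `D` and every
primitive quadratic `χ (mod D)`:
`|discMean(H_u + cΛ_s(D,χ)^{−1/2}H_λ) − (𝔅(u) + 2Re(κ_×(u,λ)c) + |c|²K_Λ(λ))·𝔞𝔓| ≤ ε·𝔞𝔓`.
The three parameters have no closed form in print or in the cell's files; ls-theory's recipe (PNT rule in place of the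
dipole rule inside formula I's residue-weight skeleton) is the derivation that instantiates them. Nothing asserted.
[cite: Zhang2022LandauSiegel, §7 Prop 7.1 (7.2); §8 (8.3), Lemma 8.1] -/
def EMultiLambda (c' : ℝ) (K : LambdaDiag) (X : LambdaCross) (Λs : BandScale) : Prop :=
  ∀ (u u' : ℝ → ℂ), KinkedProfile u u' → u 1 = 0 → ∀ (L : LambdaPiece), L.Admissible → ∀ (c : ℂ) (ε : ℝ), 0 < ε →
    ForAllLarge fun D _ χ => AssumptionA D χ →
      |discMean c' χ (lambdaDesign χ u L c (Λs D χ)) - lambdaBlockMainTerm K X u u' L c * frakA χ * frakP D|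
        ≤ ε * frakA χ * frakP D

/-- **Claim Q1(i): the Λ×Λ diagonal is `≥ 0`** (a genuine `|·|²`, `χ`-free) on admissible pieces.
[cite: Zhang2022LandauSiegel, §7 Prop 7.1 (7.2)] -/
def LambdaDiagNonneg (K : LambdaDiag) : Prop := ∀ L : LambdaPiece, L.Admissible → 0 ≤ K L

/-- **Claim (B1) for the block: the cross term is Cauchy–Schwarz-subordinate,** `|κ_×(u,λ)|² ≤ 𝔅(u)·K_Λ(λ)` on every
in-class `u` and admissible `λ` (under Lemma 2.3 / `ω > 0` the true form over any coefficient class is a sum of `|·|²`;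
a violation by the DERIVED block would signal a dictionary defect). [cite: Zhang2022LandauSiegel, §2 Lemma 2.3, (2.15)] -/
def LambdaBlockCS (K : LambdaDiag) (X : LambdaCross) : Prop :=
  ∀ (u u' : ℝ → ℂ) (L : LambdaPiece), KinkedProfile u u' → u 1 = 0 → L.Admissible →
    ‖X u u' L‖ ^ 2 ≤ mainTermForm u u' * K L

/-- **E-030 CLOSES — the decision statement** (the M2 «candidate» word in the POS currency): some realised Λ-design
has a NEGATIVE block value. [cite: Zhang2022LandauSiegel, §7 Prop 7.1 (7.2)] -/
def EMultiLambdaCloses (K : LambdaDiag) (X : LambdaCross) : Prop :=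
  ∃ (u u' : ℝ → ℂ) (L : LambdaPiece) (c : ℂ), KinkedProfile u u' ∧ u 1 = 0 ∧ L.Admissible ∧
    lambdaBlockMainTerm K X u u' L c < 0

/-- **The EDGE-REPORT shape (B-multi/PLAN.md §4 step 5, «knife edge #3»):** the derived block is INDEFINITE on some
design — `𝔅(u)·K_Λ(λ) < |κ_×(u,λ)|²`. [cite: Zhang2022LandauSiegel, §7 Prop 7.1 (7.2)] -/
def LambdaBlockIndefinite (K : LambdaDiag) (X : LambdaCross) : Prop :=
  ∃ (u u' : ℝ → ℂ) (L : LambdaPiece), KinkedProfile u u' ∧ u 1 = 0 ∧ L.Admissible ∧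
    mainTermForm u u' * K L < ‖X u u' L‖ ^ 2

/-! ### Part 3 — PROVED: the M2 certificate, the indefinite ⇒ closes direction, and the POS endgame -/

section Certificate

variable {K : LambdaDiag} {X : LambdaCross}

/-- **The M2 certificate:** for `𝔅(u) ≥ 0`, `K_Λ ≥ 0` and a CS-subordinate cross term,
`(√𝔅(u) − |c|·√K_Λ)² ≤ 𝔅(u) + 2Re(κ_×c) + |c|²K_Λ` at every amplitude — in particular the block value is `≥ 0`.
[cite: Zhang2022LandauSiegel, §2 Lemma 2.3, (2.15)] -/
theorem sq_sqrt_sub_le_lambdaBlockMainTerm {u u' : ℝ → ℂ} {L : LambdaPiece} (hB : 0 ≤ mainTermForm u u')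
    (hK : 0 ≤ K L) (hcs : ‖X u u' L‖ ^ 2 ≤ mainTermForm u u' * K L) (c : ℂ) :
    (Real.sqrt (mainTermForm u u') - Real.sqrt (‖c‖ ^ 2 * K L)) ^ 2 ≤ lambdaBlockMainTerm K X u u' L c := by
  have hV : 0 ≤ ‖c‖ ^ 2 * K L := mul_nonneg (sq_nonneg _) hK
  have hx : ‖X u u' L * c‖ ^ 2 ≤ mainTermForm u u' * (‖c‖ ^ 2 * K L) := by
    rw [norm_mul, mul_pow]
    nlinarith [sq_nonneg ‖c‖]
  have h := sq_sqrt_sub_sqrt_le hB hV hx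
  unfold lambdaBlockMainTerm
  linarith

/-- **No realised Λ-design has a negative block value while `K_Λ ≥ 0` and the cross term is CS-subordinate**
(`𝔅(u) ≥ 0` on kinked in-class pieces: `mainTermForm_nonneg_of_isH1`).
[cite: Zhang2022LandauSiegel, §2 Lemma 2.3, (2.15), §7 Prop 7.1] -/
theorem lambdaBlockMainTerm_nonneg_of_cs (hK : LambdaDiagNonneg K) (hX : LambdaBlockCS K X)
    {u u' : ℝ → ℂ} (hu : KinkedProfile u u') (hu1 : u 1 = 0) {L : LambdaPiece} (hL : L.Admissible) (c : ℂ) :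
    0 ≤ lambdaBlockMainTerm K X u u' L c := by
  have hB : 0 ≤ mainTermForm u u' := mainTermForm_nonneg_of_isH1 hu.isH1
  have h := sq_sqrt_sub_le_lambdaBlockMainTerm hB (hK L hL) (hX u u' L hu hu1 hL) c
  exact le_trans (sq_nonneg _) h

/-- **The (B1) prediction as bookkeeping — the registry's «no» word for class M2:** with `K_Λ ≥ 0` and a
CS-subordinate `κ_×`, E-030 never closes. [cite: Zhang2022LandauSiegel, §2 Lemma 2.3, (2.15)] -/
theorem not_eMultiLambdaCloses_of_cs (hK : LambdaDiagNonneg K) (hX : LambdaBlockCS K X) :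
    ¬ EMultiLambdaCloses K X := by
  rintro ⟨u, u', L, c, hu, hu1, hL, hneg⟩
  exact not_lt.2 (lambdaBlockMainTerm_nonneg_of_cs hK hX hu hu1 hL c) hneg

/-- **An indefinite block with `K_Λ > 0` closes**, at the amplitude `c = −conj κ_× / K_Λ`, where the block value is
`𝔅(u) − |κ_×|²/K_Λ < 0`. (The knife-edge-#3 report made quantitative: the optimal amplitude and the margin.)
[cite: Zhang2022LandauSiegel, §7 Prop 7.1 (7.2)] -/
theorem lambdaBlockMainTerm_neg_of_indefinite {u u' : ℝ → ℂ} {L : LambdaPiece} (hK : 0 < K L)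
    (h : mainTermForm u u' * K L < ‖X u u' L‖ ^ 2) :
    lambdaBlockMainTerm K X u u' L (-(starRingEnd ℂ) (X u u' L) / (K L : ℂ)) < 0 := by
  set x : ℂ := X u u' L with hx
  have hKne : (K L : ℂ) ≠ 0 := by exact_mod_cast hK.ne'
  -- the cross term at the optimal amplitude: `x · (−x̄/K) = −|x|²/K`
  have hcross : (x * (-(starRingEnd ℂ) x / (K L : ℂ))).re = -(‖x‖ ^ 2 / K L) := by
    have e : x * (-(starRingEnd ℂ) x / (K L : ℂ)) = -(((‖x‖ ^ 2 / K L : ℝ)) : ℂ) := by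
      rw [Complex.ofReal_div, Complex.ofReal_pow, ← Complex.mul_conj']
      field_simp
    rw [e, Complex.neg_re, Complex.ofReal_re]
  -- the amplitude's size: `|−x̄/K|² = |x|²/K²`
  have hnorm : ‖-(starRingEnd ℂ) x / (K L : ℂ)‖ ^ 2 = ‖x‖ ^ 2 / K L ^ 2 := by
    rw [norm_div, norm_neg, Complex.norm_conj, Complex.norm_real, Real.norm_eq_abs, abs_of_pos hK, div_pow]
  rw [lambdaBlockMainTerm, hcross, hnorm]
  have e2 : mainTermForm u u' + 2 * -(‖x‖ ^ 2 / K L) + ‖x‖ ^ 2 / K L ^ 2 * K L =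
      (mainTermForm u u' * K L - ‖x‖ ^ 2) / K L := by
    field_simp
    ring
  rw [e2]
  exact div_neg_of_neg_of_pos (by linarith) hK

/-- **Indefinite ⇒ closes** (given `K_Λ > 0` on admissible pieces). [cite: Zhang2022LandauSiegel, §7 Prop 7.1 (7.2)] -/
theorem eMultiLambdaCloses_of_indefinite (hK : ∀ L : LambdaPiece, L.Admissible → 0 < K L)
    (h : LambdaBlockIndefinite K X) : EMultiLambdaCloses K X := by
  obtain ⟨u, u', L, hu, hu1, hL, hind⟩ := h
  exact ⟨u, u', L, _, hu, hu1, hL, lambdaBlockMainTerm_neg_of_indefinite (hK L hL) hind⟩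

/-- … hence an indefinite block is NOT Cauchy–Schwarz-subordinate: the edge report negates the (B1) claim on that
design. [cite: Zhang2022LandauSiegel, §2 Lemma 2.3, (2.15)] -/
theorem lambdaBlockIndefinite_not_cs (h : LambdaBlockIndefinite K X) : ¬ LambdaBlockCS K X := by
  obtain ⟨u, u', L, hu, hu1, hL, hind⟩ := h
  intro hcs
  exact not_lt.2 (hcs u u' L hu hu1 hL) hind

/-- Conversely CS on every design excludes the edge report. [cite: Zhang2022LandauSiegel, §2 Lemma 2.3, (2.15)] -/
theorem not_lambdaBlockIndefinite_of_cs (hcs : LambdaBlockCS K X) : ¬ LambdaBlockIndefinite K X :=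
  fun h => lambdaBlockIndefinite_not_cs h hcs

end Certificate

section Endgame

variable {c' : ℝ} {K : LambdaDiag} {X : LambdaCross} {Λs : BandScale}

/-- **B-multi's POS endgame for the Λ class as a kernel implication: E-030 + its closing + Zhang's Part-1 zero model
⇒ Theorem 1 of the manuscript** (family positivity endgame `eventually_not_assumptionA_of_negative_mainTerm_family` +
`Skeleton.theorem1_of_eventually_not_assumptionA`). Both `E` hypotheses are OPEN (registry E-030; prediction B-AH: the
closing fails, `not_eMultiLambdaCloses_of_cs`); `Prop22i`, `Lemma23 c'` are CLAIMS of the manuscript — nothing is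
asserted. [cite: Zhang2022LandauSiegel, §2 p. 6, Lemma 2.3, Prop. 2.2 (i), §7 Prop 7.1 (7.2)] -/
theorem theorem1_of_eMultiLambda (hE : EMultiLambda c' K X Λs) (hC : EMultiLambdaCloses K X) (h22 : Prop22i)
    (h23 : Lemma23 c') : Theorem1 := by
  obtain ⟨u, u', L, c, hu, hu1, hL, hneg⟩ := hC
  exact Skeleton.theorem1_of_eventually_not_assumptionA
    (eventually_not_assumptionA_of_negative_mainTerm_family hneg (hE u u' hu hu1 L hL c) h22 h23)

/-- … and Theorem 2. [cite: Zhang2022LandauSiegel, §1 Theorem 2] -/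
theorem theorem2_of_eMultiLambda (hE : EMultiLambda c' K X Λs) (hC : EMultiLambdaCloses K X) (h22 : Prop22i)
    (h23 : Lemma23 c') : Theorem2 :=
  Skeleton.theorem2_of_theorem1 (theorem1_of_eMultiLambda hE hC h22 h23)

/-- **The edge-report route to the endgame:** E-030 with `K_Λ > 0` and an INDEFINITE derived block would already give
Theorem 1 — which is why ls-theory prices a derived indefinite block first as a dictionary-consistency test.
[cite: Zhang2022LandauSiegel, §2 p. 6, §7 Prop 7.1 (7.2)] -/
theorem theorem1_of_eMultiLambda_indefinite (hE : EMultiLambda c' K X Λs)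
    (hK : ∀ L : LambdaPiece, L.Admissible → 0 < K L) (hI : LambdaBlockIndefinite K X) (h22 : Prop22i)
    (h23 : Lemma23 c') : Theorem1 :=
  theorem1_of_eMultiLambda hE (eMultiLambdaCloses_of_indefinite hK hI) h22 h23

end Endgame

/-! ### Part 4 — STEP 2 (INERT EXHIBIT after the §B-multi KILL word of 2026-08-26T18:10:26Z): the closed forms
`(K_Λ, κ_×, Λ_s)` for the PURE prime-supported class with `k = 1`, read off Prop 7.1's `S_j` — a DERIVATION
(status HEURISTIC, like formula I itself: it uses the (A)-world dipole/PNT rules and the main profiles of the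
local weights at primes), typed as definitions; NOTHING is asserted about the manuscript.

**The dictionary of formula I** (`Repair.Mform`, module docstring of `RepairFormulaIGram`): in
`S_j(a₁,a₂) = Σ_{d,r} |μ(r)|λ₀ⱼ(dr)/(drφ(r))·(Σ_m a₁(drm)m^{β_j−1})·(Σ_n a₂(drn)ξ₀ⱼ(n;d,r)/n)` [§7, Prop 7.1], for
smooth `χ`-pieces `a₁(n) = χ(n)g(z_n)`, `a₂(n) = χ(n)conj h(z_n)` (`z_n = log n/L_M`, `L_M = log P`, `αL_M = π`,
`β_j = ijα`) and outer position `y = z_{dr} < 1 − 2τ`: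
(D-m) `Σ_m χ(m)m^{β_j−1}g(y+z_m) ≐ −(L′(1,χ)/L_M)·(A_jg)(y)`, `A_jg = g′ + iπjg` [Lemma 8.2];
(D-n) `Σ_n χ(n)ξ₀ⱼ(n;d,r)conj h(y+z_n)/n ≐ −(L′(1,χ)Π(d,r)/L_M)·conj((B_jh)(y))`, `B_jh = h′ + iπS_jh + π²N_j∫_y^1h`
[Lemmas 8.3/8.4]; (D-out) `Σ_{dr<x}|μ(r)|λ₀ⱼ(dr)Π(d,r)/(drφ(r))·F(z_{dr}) ≐ 𝔞₀L_M∫F(y)dy` [(8.10), `λ₀ⱼ(n) ≐ φ(n)²/n²`,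
`𝔞₀ = (6/π²)Π_{q|D}q/(q+1)`, `𝔞 = 𝔞₀L′(1,χ)²`]; assembly `Θ₁ ≐ (L_M/π)Σ_jW_jS_j·𝔓` ⇒ `Θ₁(a_g,a_h̄) ≐ 𝔞𝔓·M(g,h)`.

**Reading it on the Λ-piece** `a_λ(n) = χ(n)(Λ(n)/L_M)p(z_n)` (`z_n ≤ ν < 1`; `p = L.prof`, `ν = L.top`). A
prime-power-supported factor forces the outer variable `dr` into `{1} ∪ {q^e}`; prime powers with exponent `≥ 2` and
the inner terms `m, n ≠ 1` at `dr = q` are `O(1/L_M)` relatively (`Σ_q log q/q² < ∞`) and are dropped. Local data at a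
prime `q ∤ D`: `κ(q) = q^{−β₁}+q^{−β₂}+q^{−β₃}−1` (`Σκ(n)n^{−s} = ζ(s+β₁)ζ(s+β₂)ζ(s+β₃)/ζ(s)`, §7), `κ̃₀ⱼ(1;q) = κ(1) = 1`,
`λ₀ⱼ(q), λ̃₀ⱼ(q,1) = 1 + O(1/q)`, hence `ξ₀ⱼ(1;d,r) = 1` and `ξ₀ⱼ(q;1,1) ≐ q^{−β_{j′}} + q^{−β_{j″}} − 1 =: ξ̂_j(z_q)`
(`{j′,j″} = {1,2,3}∖{j}`; `q^{±β_b} = e^{±iπbz_q}`), and `Σ_{dr=q}|μ(r)|λ₀ⱼ(q)/(qφ(r))·{1, Π(d,r)} ≐ 1/q`. The two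
(A)-world prime-sum rules: (PNT) `(1/L_M)Σ_q (log q/q)F(z_q) ≐ ∫F` (χ-free); (PNT⁻) `Σ_q χ(q)Λ(q)q^{−1+β}F(z_q) ≐
−L_M∫e^{(βL_M)z}F(z)dz` — under (A) the real zero `ρ̃` of `L(s,χ)` [Lemma 5.5] makes `χ(q)` act as `−1` on these
scales (`Σχ(n)Λ(n)n^{−w} = −L′/L(w,χ) ≐ −1/(w−1)`), the rule ls-theory named (cell INBOX 2026-08-26T16:51:20Z Q1(iii)).
Then, with `p̂_j = ∫₀^ν e^{iπjz}p`, `q̂_j = ∫₀^ν conj(ξ̂_j)·p` (`lambdaHat`, `lambdaXiHat`):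
* `S_j(λ,λ̄) ≐ ∫₀^ν z|p(z)|²dz` [dr = q, χ-FREE: `|χ(q)|² = 1`] `+ p̂_j·conj q̂_j` [dr = 1: product of the two twisted
  prime sums, (PNT⁻)²] — `lambdaDiagS`; NO `L′(1,χ)`, NO `1/L_M`;
* `S_j(λ,ū) ≐ (L′/L_M)·[p̂_j·conj((B_ju)(0)) − ∫₀^ν p·conj(B_ju)]`, `S_j(u,λ̄) ≐ (L′/L_M)·[(A_ju)(0)·conj q̂_j −
  ∫₀^ν (A_ju)·p̄]` [dr = 1: (PNT⁻) × dipole at `y = 0`; dr = q: the smooth factor's `χ(q)` cancels the Λ-factor's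
  (`χ(q)² = 1`), χ-free (PNT), one dipole factor] — `lambdaCrossS1/S2`;
* `S_j(u,ū) ≐ (𝔞/L_M)∫(A_ju)conj(B_ju)` (formula I).
SIZES per `S_j`: `u×u ≍ 𝔞/L_M`, `u×λ ≍ L′/L_M`, `λ×λ ≍ 1`; so `|cross|²/(diag·diag) ≍ (L′/L_M)²/(𝔞/L_M) = 1/(𝔞₀L_M) → 0`.
In units of `𝔞𝔓`, for the design `H_u + ε·H_λ`: `discMean ≐ [𝔅(u) + 2Re(ε·(L′/𝔞)·X(u,λ)) + |ε|²(L_M/𝔞)·K_Λ(λ)]·𝔞𝔓`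
with `K_Λ = (2/π)Re Σ_jW_jS_j(λ,λ̄)` (`lambdaDiagFormulaI`) and `X = X₁ + conj X₂` (`lambdaCrossRaw`). The BALANCING
SCALE is therefore `Λ_s(D,χ) = L_M/𝔞(χ) = log P/𝔞` (`lambdaScaleFormulaI`; NOT the band scale of E-005), and at
`ε = c·Λ_s^{−1/2}` the cross coefficient is `c·(L′/𝔞)(𝔞/L_M)^{1/2} = ±c·(𝔞₀L_M)^{−1/2} → 0`: **at main order the
pure Λ-piece DECOUPLES, `κ_× = 0`** (`lambdaCrossFormulaI`), the block is `diag(𝔅(u), K_Λ)`, the knife-edge-#3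
quantity is `𝔅(u*) ≥ 0` identically, and the dictionary-consistency content of STEP 2 is the sign claim
`LambdaDiagNonneg lambdaDiagFormulaI` (not a separate definition; `K_Λ(λ) ≥ 0` for every admissible piece — Lemma 2.3 applied to `H_λ` alone
demands it; spot values: `p ≡ 1`, `ν → 0`: `K_Λ ≐ (2/π)·6ν²`; `p ≡ 1`, `ν = ½`: `(2/π)(0.5 + 0.37)`). ls-theory's
Q1(ii) «geometric-mean cross» is NOT what the pure class gives; it is the reading for the Feng CONVOLUTION class
`χ(n)Σ_{q|n}(Λ(q)/L_M)p(z_q)κ(z_{n/q})` (full support; cell INBOX 2026-08-26T17:56:03Z Q→theory, open) — not typed here.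
[cite: Zhang2022LandauSiegel, §7 Prop 7.1 (7.2), (κ); §8 Lemmas 8.2–8.4, (8.10)–(8.12); §5 Lemma 5.5] -/

section StepTwo

/-- `e^{iπbz}` — the main value of `q^{β_b}` at `z = z_q` (`β_b = ibα`, `αL_M = π`).
[cite: Zhang2022LandauSiegel, §8 (8.13)–(8.18)] -/
def phaseB (b : ℕ) (z : ℝ) : ℂ := Complex.exp (I * π * (b : ℂ) * z)

/-- `ξ̂_j(z) = e^{−iπj′z} + e^{−iπj″z} − 1` (`{j′,j″} = {1,2,3}∖{j}`) — the main profile of `ξ₀ⱼ(q;1,1)` at a prime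
`q` with `z_q = z`, from `κ(q) = q^{−β₁}+q^{−β₂}+q^{−β₃}−1` and the factorisation `q = 1·q` (`μ(q)q^{1−β_j}/φ(q) ≐ −q^{−β_j}`).
[cite: Zhang2022LandauSiegel, §7 (ξ₀ⱼ, κ̃, κ)] -/
def xiHat (j : ℕ) (z : ℝ) : ℂ :=
  Complex.exp (-(I * π * z)) + Complex.exp (-(I * π * 2 * z)) + Complex.exp (-(I * π * 3 * z))
    - Complex.exp (-(I * π * (j : ℂ) * z)) - 1

/-- `p̂_j = ∫₀^ν e^{iπjz}p(z)dz` — the (PNT⁻) main value of `−(1/L_M)Σ_q χ(q)Λ(q)q^{β_j−1}p(z_q)`.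
[cite: Zhang2022LandauSiegel, §7 Prop 7.1; §5 Lemma 5.5] -/
def lambdaHat (j : ℕ) (L : LambdaPiece) : ℂ := ∫ z in (0:ℝ)..L.top, phaseB j z * L.prof z

/-- `q̂_j = ∫₀^ν conj(ξ̂_j(z))·p(z)dz`, so that `conj q̂_j` is the (PNT⁻) main value of
`−(1/L_M)Σ_q χ(q)Λ(q)ξ₀ⱼ(q;1,1)conj p(z_q)/q`. [cite: Zhang2022LandauSiegel, §7 Prop 7.1; §5 Lemma 5.5] -/
def lambdaXiHat (j : ℕ) (L : LambdaPiece) : ℂ := ∫ z in (0:ℝ)..L.top, (starRingEnd ℂ) (xiHat j z) * L.prof z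

/-- `∫₀^ν z|p(z)|²dz` — the χ-free prime diagonal `(1/L_M²)Σ_q (log q)²|p(z_q)|²/q` (ls-theory's Q1(iii) term).
[cite: Zhang2022LandauSiegel, §7 Prop 7.1] -/
def lambdaMass (L : LambdaPiece) : ℝ := ∫ z in (0:ℝ)..L.top, z * ‖L.prof z‖ ^ 2

/-- The main value of `S_j(λ,λ̄)`: `∫₀^ν z|p|² + p̂_j·conj q̂_j`. [cite: Zhang2022LandauSiegel, §7 Prop 7.1] -/
def lambdaDiagS (j : ℕ) (L : LambdaPiece) : ℂ :=
  ((lambdaMass L : ℝ) : ℂ) + lambdaHat j L * (starRingEnd ℂ) (lambdaXiHat j L)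

/-- `K₀(λ) = (1/π)(½S₁ + 2S₂ + 3/2·S₃)(λ,λ̄)` — Prop 7.1's weights. [cite: Zhang2022LandauSiegel, §7 Prop 7.1] -/
def lambdaDiagK0 (L : LambdaPiece) : ℂ :=
  (((1 / π : ℝ)) : ℂ) * (1 / 2 * lambdaDiagS 1 L + 2 * lambdaDiagS 2 L + 3 / 2 * lambdaDiagS 3 L)

/-- **`K_Λ(λ) = 2Re K₀(λ)` — the derived diagonal functional of the pure class (`k = 1`) in balanced units**
(`discMean(H_λ) ≐ (L_M/𝔞)·K_Λ(λ)·𝔞𝔓 = K_Λ(λ)·log P·𝔓`; the `2Re` is Lemma 8.1's `Ξ = 2Re Θ₁`). Derivation, Part 4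
docstring; its sign on admissible pieces is the dictionary-consistency claim `LambdaDiagNonneg lambdaDiagFormulaI`.
[cite: Zhang2022LandauSiegel, §7 Prop 7.1, §8 Lemma 8.1] -/
def lambdaDiagFormulaI : LambdaDiag := fun L => 2 * (lambdaDiagK0 L).re

/-- **The balancing scale of the pure class: `Λ_s(D,χ) = log P/𝔞(χ)`** (amplitude `ε = c·(𝔞/log P)^{1/2}` makes
`|ε|²·discMean(H_λ) ≐ |c|²K_Λ·𝔞𝔓`; junk value `0` at the non-modulus `D = 0`). [cite: Zhang2022LandauSiegel, §2 (2.31), §7 Prop 7.1] -/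
def lambdaScaleFormulaI : BandScale := fun D χ =>
  if h : D = 0 then 0 else
    haveI : NeZero D := ⟨h⟩
    Real.log (bigP D) / frakA χ

/-- `A_ju = u′ + iπju` (the `m`-slot dipole operator of formula I). [cite: Zhang2022LandauSiegel, §8 Lemma 8.2] -/
def dipoleA (j : ℕ) (u u' : ℝ → ℂ) (y : ℝ) : ℂ := u' y + I * π * (j : ℂ) * u y

/-- `B_ju = u′ + iπS_ju + π²N_j∫_y^1u` (the `n`-slot dipole operator of formula I).
[cite: Zhang2022LandauSiegel, §8 Lemma 8.4] -/
def dipoleB (j : ℕ) (u u' : ℝ → ℂ) (y : ℝ) : ℂ :=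
  u' y + I * π * ((bS j : ℝ) : ℂ) * u y + (π : ℂ) ^ 2 * ((bN j : ℝ) : ℂ) * ∫ t in y..1, u t

/-- The main value of `(L_M/L′(1,χ))·S_j(λ,ū)`: `p̂_j·conj((B_ju)(0)) − ∫₀^ν p·conj(B_ju)`.
[cite: Zhang2022LandauSiegel, §7 Prop 7.1, §8 Lemmas 8.2–8.4] -/
def lambdaCrossS1 (j : ℕ) (u u' : ℝ → ℂ) (L : LambdaPiece) : ℂ :=
  lambdaHat j L * (starRingEnd ℂ) (dipoleB j u u' 0)
    - ∫ z in (0:ℝ)..L.top, L.prof z * (starRingEnd ℂ) (dipoleB j u u' z)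

/-- The main value of `(L_M/L′(1,χ))·S_j(u,λ̄)`: `(A_ju)(0)·conj q̂_j − ∫₀^ν (A_ju)·conj p`.
[cite: Zhang2022LandauSiegel, §7 Prop 7.1, §8 Lemmas 8.2–8.4] -/
def lambdaCrossS2 (j : ℕ) (u u' : ℝ → ℂ) (L : LambdaPiece) : ℂ :=
  dipoleA j u u' 0 * (starRingEnd ℂ) (lambdaXiHat j L)
    - ∫ z in (0:ℝ)..L.top, dipoleA j u u' z * (starRingEnd ℂ) (L.prof z)

/-- `X₁(u,λ) = (1/π)Σ_jW_j·lambdaCrossS1` (`Θ₁(a_λ,a_ū) ≐ (L′/𝔞)·X₁·𝔞𝔓`). [cite: Zhang2022LandauSiegel, §7 Prop 7.1] -/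
def lambdaCrossX1 (u u' : ℝ → ℂ) (L : LambdaPiece) : ℂ :=
  (((1 / π : ℝ)) : ℂ) *
    (1 / 2 * lambdaCrossS1 1 u u' L + 2 * lambdaCrossS1 2 u u' L + 3 / 2 * lambdaCrossS1 3 u u' L)

/-- `X₂(u,λ) = (1/π)Σ_jW_j·lambdaCrossS2` (`Θ₁(a_u,a_λ̄) ≐ (L′/𝔞)·X₂·𝔞𝔓`). [cite: Zhang2022LandauSiegel, §7 Prop 7.1] -/
def lambdaCrossX2 (u u' : ℝ → ℂ) (L : LambdaPiece) : ℂ :=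
  (((1 / π : ℝ)) : ℂ) *
    (1 / 2 * lambdaCrossS2 1 u u' L + 2 * lambdaCrossS2 2 u u' L + 3 / 2 * lambdaCrossS2 3 u u' L)

/-- **The raw (unbalanced, `O(1)`) cross functional `X = X₁ + conj X₂`:** the design `H_u + εH_λ` has cross main
term `2Re(ε·(L′(1,χ)/𝔞)·X(u,λ))·𝔞𝔓`; at the balanced amplitude `ε = cΛ_s^{−1/2}` its coefficient is
`±c·(𝔞₀ log P)^{−1/2}·X → 0`. Recorded so that a numerics seat can exhibit the rate; it is NOT the block's `κ_×`.
[cite: Zhang2022LandauSiegel, §7 Prop 7.1, §8 Lemma 8.1] -/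
def lambdaCrossRaw : LambdaCross := fun u u' L => lambdaCrossX1 u u' L + (starRingEnd ℂ) (lambdaCrossX2 u u' L)

/-- **`κ_× = 0` at main order in balanced units for the pure class** (the cross is `(𝔞₀ log P)^{−1/2}`-suppressed:
Part 4 docstring, SIZES). [cite: Zhang2022LandauSiegel, §7 Prop 7.1] -/
def lambdaCrossFormulaI : LambdaCross := fun _ _ _ => 0

/-- **E-030 for the pure class, instantiated (the STEP-2 row):** `EMultiLambda c' K_Λ 0 (log P/𝔞)` — under (A),
`discMean(H_u + c(𝔞/log P)^{1/2}H_λ) = (𝔅(u) + |c|²K_Λ(λ))·𝔞𝔓 + o(𝔞𝔓)`. Bare `Prop` (derivation claim, HEURISTIC);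
nothing asserted. [cite: Zhang2022LandauSiegel, §7 Prop 7.1 (7.2), §8 Lemma 8.1] -/
def EMultiLambdaFormulaI (c' : ℝ) : Prop :=
  EMultiLambda c' lambdaDiagFormulaI lambdaCrossFormulaI lambdaScaleFormulaI

variable {K : LambdaDiag}

/-- With `κ_× = 0` the block value is `𝔅(u) + |c|²K_Λ(λ)`. [cite: Zhang2022LandauSiegel, §7 Prop 7.1 (7.2)] -/
theorem lambdaBlockMainTerm_crossZero (u u' : ℝ → ℂ) (L : LambdaPiece) (c : ℂ) :
    lambdaBlockMainTerm K lambdaCrossFormulaI u u' L c = mainTermForm u u' + ‖c‖ ^ 2 * K L := by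
  simp [lambdaBlockMainTerm, lambdaCrossFormulaI]

/-- A vanishing cross term is Cauchy–Schwarz-subordinate whenever `K_Λ ≥ 0`.
[cite: Zhang2022LandauSiegel, §2 Lemma 2.3, (2.15)] -/
theorem lambdaBlockCS_crossZero (hK : LambdaDiagNonneg K) : LambdaBlockCS K lambdaCrossFormulaI := by
  intro u u' L hu _ hL
  have hB : 0 ≤ mainTermForm u u' := mainTermForm_nonneg_of_isH1 hu.isH1
  simpa [lambdaCrossFormulaI] using mul_nonneg hB (hK L hL)

/-- **The pure Λ class never closes once its derived diagonal is `≥ 0`** (decoupling + `𝔅(u) ≥ 0`): the M2-pure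
word is «no» by (B1) with a vanishing cross, not a knife edge. [cite: Zhang2022LandauSiegel, §2 Lemma 2.3, (2.15)] -/
theorem not_eMultiLambdaCloses_crossZero (hK : LambdaDiagNonneg K) : ¬ EMultiLambdaCloses K lambdaCrossFormulaI :=
  not_eMultiLambdaCloses_of_cs hK (lambdaBlockCS_crossZero hK)

/-- In particular for the derived `K_Λ`: the DICTIONARY-CONSISTENCY claim of STEP 2, `LambdaDiagNonneg
lambdaDiagFormulaI` (`K_Λ ≥ 0` on admissible pieces — Lemma 2.3 applied to `H_λ` alone requires it; a certified negative
value would be read as a derivation defect, cell INBOX 2026-08-26T18:06:49Z), implies no closing in the pure class.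
[cite: Zhang2022LandauSiegel, §2 Lemma 2.3, (2.15)] -/
theorem not_eMultiLambdaCloses_formulaI (h : LambdaDiagNonneg lambdaDiagFormulaI) :
    ¬ EMultiLambdaCloses lambdaDiagFormulaI lambdaCrossFormulaI :=
  not_eMultiLambdaCloses_crossZero h

/-- … and the edge report is excluded. [cite: Zhang2022LandauSiegel, §2 Lemma 2.3, (2.15)] -/
theorem not_lambdaBlockIndefinite_formulaI (h : LambdaDiagNonneg lambdaDiagFormulaI) :
    ¬ LambdaBlockIndefinite lambdaDiagFormulaI lambdaCrossFormulaI :=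
  not_lambdaBlockIndefinite_of_cs (lambdaBlockCS_crossZero h)

end StepTwo

/-! ### Part 5 — the FENG CONVOLUTION class (inert appendix): coefficients `χψ(n)·Σ_{qm=n}(Λ^{⋆k}(q)/log^kP)p(z_q)κ(z_m)`
— the literal transplant of Feng's second mollifier piece `μ(j)Σ_{p₁⋯p_k | j} (log p₁⋯log p_k/log^k y)P(…)`
([Feng2012CriticalLine] (1.11)) with `χ` in the role of `μ`: FULL support in `n`, one smooth `χψ`-factor `κ` convolved
with the prime-supported factor. This is the class for which ls-theory's reading (cell INBOX 2026-08-26T16:51:20Z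
Q1(ii): «exactly ONE χ survives on the smooth variable ⇒ cross of geometric-mean, CS-saturating order») is phrased; the
PURE class of Parts 1–4 decouples instead (Part 4). Typed as definitions + the row as a bare `Prop` parametric in the
block functionals, re-using the 2×2 algebra of Part 3 by currying; NO closed form is derived here (open: cell INBOX
2026-08-26T17:56:03Z (a)). [cite: Zhang2022LandauSiegel, §7 Prop 7.1 (7.2)] [cite: Feng2012CriticalLine, (1.11)] -/

section FengClass

/-- **The Feng-convolution polynomial** `H_F(s,ψ) = Σ_{qm < ⌈P⌉, q < ⌈P^ν⌉} χψ(qm)·(Λ^{⋆k}(q)/log^kP)·p(z_q)·κ(z_m)·(qm)^{−s}`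
(smooth factor `κ`, Λ-factor `L = (k, ν, p)`; total length `P`). [cite: Zhang2022LandauSiegel, §2 (2.23)–(2.25), §7 (7.2)]
[cite: Feng2012CriticalLine, (1.11)] -/
def fengConvPoly {D : ℕ} (χ : DirichletCharacter ℂ D) (x : Chr D) (κ : ℝ → ℂ) (L : LambdaPiece) (s : ℂ) : ℂ :=
  ∑ q ∈ Finset.Ico 1 ⌈bigP D ^ L.top⌉₊, ∑ m ∈ Finset.Ico 1 ⌈bigP D⌉₊,
    if q * m < ⌈bigP D⌉₊ then
      pc χ x (q * m) * ((lambdaWeight L.k (Real.log (bigP D)) q : ℝ) : ℂ) *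
        L.prof (Real.log q / Real.log (bigP D)) * κ (Real.log m / Real.log (bigP D)) * ((q * m : ℕ) : ℂ) ^ (-s)
    else 0

/-- **The realised Feng design** `H_u + c·Λ_s^{−1/2}·H_F` as a value table. [cite: Zhang2022LandauSiegel, §2 (2.27), §7 (7.2)] -/
def fengDesign {D : ℕ} (χ : DirichletCharacter ℂ D) (u κ : ℝ → ℂ) (L : LambdaPiece) (c : ℂ) (scale : ℝ) :
    Chr D → ℂ → ℂ := fun x s =>
  profPoly χ x u ⌈bigP D⌉₊ s + c * (((Real.sqrt scale)⁻¹ : ℝ) : ℂ) * fengConvPoly χ x κ L s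

/-- The Feng-class diagonal functional `K_F(κ, L)` (parameter). [cite: Zhang2022LandauSiegel, §7 Prop 7.1 (7.2)] -/
abbrev FengDiag : Type := (ℝ → ℂ) → (ℝ → ℂ) → LambdaPiece → ℝ

/-- The Feng-class cross functional `κ_F(u; κ, L)` (parameter; theory's reading: one dipole factor on each side, CS order).
[cite: Zhang2022LandauSiegel, §7 Prop 7.1 (7.2), §8 Lemma 8.1] -/
abbrev FengCross : Type := (ℝ → ℂ) → (ℝ → ℂ) → (ℝ → ℂ) → (ℝ → ℂ) → LambdaPiece → ℂ

/-- The block value of a Feng design at amplitude `c` — Part 3's pencil, curried at the smooth factor `(κ, κ′)`.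
[cite: Zhang2022LandauSiegel, §7 Prop 7.1 (7.2)] -/
def fengBlockMainTerm (K : FengDiag) (X : FengCross) (u u' κ κ' : ℝ → ℂ) (L : LambdaPiece) (c : ℂ) : ℝ :=
  lambdaBlockMainTerm (fun L' => K κ κ' L') (fun v v' L' => X v v' κ κ' L') u u' L c

/-- **E-030, Feng-convolution reading** (bare `Prop`, parametric in `(K_F, κ_F, Λ_s)`; derivation not started): under
(A), for in-class `u` (`u(1) = 0`), in-class smooth factor `κ` (`κ(1) = 0`), admissible `L`, every amplitude `c`:
`discMean(H_u + cΛ_s^{−1/2}H_F) = fengBlockMainTerm·𝔞𝔓 + o(𝔞𝔓)`. Nothing asserted. [cite: Zhang2022LandauSiegel, §7 Prop 7.1 (7.2); §8 Lemma 8.1] -/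
def EMultiFeng (c' : ℝ) (K : FengDiag) (X : FengCross) (Λs : BandScale) : Prop :=
  ∀ (u u' : ℝ → ℂ), KinkedProfile u u' → u 1 = 0 → ∀ (κ κ' : ℝ → ℂ), KinkedProfile κ κ' → κ 1 = 0 →
    ∀ (L : LambdaPiece), L.Admissible → ∀ (c : ℂ) (ε : ℝ), 0 < ε →
      ForAllLarge fun D _ χ => AssumptionA D χ →
        |discMean c' χ (fengDesign χ u κ L c (Λs D χ)) - fengBlockMainTerm K X u u' κ κ' L c * frakA χ * frakP D|
          ≤ ε * frakA χ * frakP D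

/-- **(B1) for the Feng block:** `|κ_F(u;κ,L)|² ≤ 𝔅(u)·K_F(κ,L)` on in-class data. [cite: Zhang2022LandauSiegel, §2 Lemma 2.3, (2.15)] -/
def FengBlockCS (K : FengDiag) (X : FengCross) : Prop :=
  ∀ (u u' κ κ' : ℝ → ℂ) (L : LambdaPiece), KinkedProfile u u' → u 1 = 0 → KinkedProfile κ κ' → κ 1 = 0 →
    L.Admissible → ‖X u u' κ κ' L‖ ^ 2 ≤ mainTermForm u u' * K κ κ' L

variable {KF : FengDiag} {XF : FengCross}

/-- **The Feng-class certificate** (Part 3 curried): `K_F ≥ 0` and CS ⇒ every Feng design has block value `≥ 0` —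
the geometric-mean-order cross of theory's reading is exactly the CS-saturating size, so definiteness is the
computation E-030 names; with CS it never closes. [cite: Zhang2022LandauSiegel, §2 Lemma 2.3, (2.15)] -/
theorem fengBlockMainTerm_nonneg_of_cs (hK : ∀ κ κ' L, KinkedProfile κ κ' → κ 1 = 0 → L.Admissible → 0 ≤ KF κ κ' L)
    (hX : FengBlockCS KF XF) {u u' κ κ' : ℝ → ℂ} (hu : KinkedProfile u u') (hu1 : u 1 = 0)
    (hκ : KinkedProfile κ κ') (hκ1 : κ 1 = 0) {L : LambdaPiece} (hL : L.Admissible) (c : ℂ) :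
    0 ≤ fengBlockMainTerm KF XF u u' κ κ' L c := by
  have hB : 0 ≤ mainTermForm u u' := mainTermForm_nonneg_of_isH1 hu.isH1
  have h := sq_sqrt_sub_le_lambdaBlockMainTerm (K := fun L' => KF κ κ' L') (X := fun v v' L' => XF v v' κ κ' L')
    hB (hK κ κ' L hκ hκ1 hL) (hX u u' κ κ' L hu hu1 hκ hκ1 hL) c
  exact le_trans (sq_nonneg _) h

/-- Conversely an indefinite Feng block with `K_F > 0` has a negative value at `c = −conj κ_F/K_F` (Part 3 curried).
[cite: Zhang2022LandauSiegel, §7 Prop 7.1 (7.2)] -/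
theorem fengBlockMainTerm_neg_of_indefinite {u u' κ κ' : ℝ → ℂ} {L : LambdaPiece} (hK : 0 < KF κ κ' L)
    (h : mainTermForm u u' * KF κ κ' L < ‖XF u u' κ κ' L‖ ^ 2) :
    fengBlockMainTerm KF XF u u' κ κ' L (-(starRingEnd ℂ) (XF u u' κ κ' L) / (KF κ κ' L : ℂ)) < 0 :=
  lambdaBlockMainTerm_neg_of_indefinite (K := fun L' => KF κ κ' L') (X := fun v v' L' => XF v v' κ κ' L') hK h

end FengClass

end KnifeEdge

end Literature.NumberTheory.LFunctions.Zhang2022
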